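import Literature.Computability.QuantumComplexity.F2PolynomialFourierTails
import HarnessLib

/-!
# Proof of CHLT Theorem 5: `L_{1,1}(Pol_{n,d}) ≤ 4d` (`CHLT2019_fourierL1LevelOne_le_holds`)

This file DISCHARGES the named fact
`Literature.Computability.QuantumComplexity.CHLT2019_fourierL1LevelOne_le` of
`F2PolynomialFourierTails.lean` — E. Chattopadhyay, P. Hatami, S. Lovett, A. Tal, *Pseudorandom
generators from the second Fourier level and applications to AC⁰ with parity gates*, ITCS 2019
(LIPIcs 124) 22, Theorem 5 (p. 22:3) = Theorem 13 (§3, pp. 22:8–22:9) [ChattopadhyayHatamiLovettTal2019]: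
for an `𝔽₂`-polynomial `p` of degree `≤ d` and `f = (-1)^p`, `∑ᵢ |f̂({i})| ≤ 4d` — by formalizing the
printed proof (held text doi:10.4230/LIPIcs.ITCS.2019.22, pp. 8–9). It introduces no definitions
(two local notations) and no new named facts.

## Architecture

We follow Chattopadhyay–Hatami–Lovett–Tal, ITCS 2019, §3 (Theorem 13 = Theorem 5, pp. 22:8–9),
working on the cube `Finset α` (`X` = the set of coordinates equal to `1`; `α = Fin m` at the end):

* `V r` = the `𝔽₂`-span of the Boolean monomials `x_S = [S ⊆ X]`, `#S ≤ r` (functions of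
  `𝔽₂`-degree `≤ r`); it is graded under products, stable under the flips `X ↦ X ∆ D`, and contains
  the Boolean function of every polynomial of total degree `≤ r` (`chlt_eval_mem`).
* Ball interpolation (`chlt_interp_low/high`): every function agrees on the Hamming ball of radius
  `k` (resp. its antipode) with an element of `V k` — the Möbius/inclusion–exclusion count
  `#[Y, X] = 2^{#X - #Y} ≡ [Y = X] (mod 2)`.
* The dimension argument (`chlt_card_agree_le`, the paper's "`|A_t| ≤ ∑_{i ≤ n/2-t+d} C(n,i)`",
  Razborov–Smolensky in Kopparty's presentation): restriction `V (k+d) → 𝔽₂^A` is onto via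
  `g = g₂ + g₁ · P`, so `2^{#A} ≤ |V (k+d)| ≤ 2^{Ball (k+d)}` (pure counting, no `finrank`).
* `chlt_level_bound`: `e_k = 2#A - #U ≤ 2 (Ball (k+d) - Ball k)`; `chlt_threshold_sum/symm`:
  `n - 2|x| = ∑_{k<n} T_k(|x|)` with `T_k = T_{n-1-k}` (parity-free replacement of the paper's
  "assume `n` even", folding `k ≥ n/2` onto `k < n/2`); the sphere double count
  (`chlt_sum_spheres_le`, `chlt_sum_fold_le`) gives `≤ 4 d 2ⁿ` (`chlt_core`).
* Fourier side (`CHLT2019_fourierL1LevelOne_le_holds`): `∑ᵢ |f̂(i)| = 2⁻ⁿ ∑ₓ f(x) ∑ᵢ (-1)^{xᵢ ⊕ σᵢ}`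
  with `σᵢ = [f̂(i) < 0]` (the paper's WLOG `sᵢ = 1`), transported to `Finset (Fin m)` and
  re-centred at `σ`.

Local notations only (no new definitions). -/

section CHLTProof

open Finset
open scoped symmDiff

namespace Literature.Computability.QuantumComplexity

section CHLTCore

variable {α : Type*} [DecidableEq α]

-- The Boolean monomial `x_S : X ↦ [S ⊆ X]` as an `𝔽₂`-valued function on the cube `Finset α`.
local notation3 "χ[" S "]" => fun X : Finset α => if S ⊆ X then (1 : ZMod 2) else 0

-- The span of the Boolean monomials of degree `≤ r` (functions of `𝔽₂`-degree `≤ r`).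
local notation3 "V[" r "]" =>
  Submodule.span (ZMod 2) (Set.range fun S : {S : Finset α // S.card ≤ r} => χ[S.1])

/-- The monomial indicator `[S ⊆ X]` is the product `∏_{i ∈ S} [i ∈ X]`. [folklore] -/
theorem chlt_ite_subset (S X : Finset α) :
    (if S ⊆ X then (1 : ZMod 2) else 0) = ∏ i ∈ S, (if i ∈ X then (1 : ZMod 2) else 0) := by
  by_cases h : S ⊆ X
  · rw [if_pos h, Finset.prod_eq_one (fun i hi => if_pos (h hi))]
  · rw [if_neg h]
    obtain ⟨i, hi, hiX⟩ := Finset.not_subset.1 h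
    rw [Finset.prod_eq_zero hi (if_neg hiX)]

/-- Monomials of degree `≤ r` lie in `V r`. [folklore] -/
theorem chlt_mono_mem {r : ℕ} {S : Finset α} (hS : S.card ≤ r) : χ[S] ∈ V[r] :=
  Submodule.subset_span ⟨⟨S, hS⟩, rfl⟩

/-- `V` is increasing in the degree. [folklore] -/
theorem chlt_V_mono {a b : ℕ} (h : a ≤ b) : V[a] ≤ V[b] :=
  Submodule.span_mono (Set.range_subset_iff.2 fun S => ⟨⟨S.1, S.2.trans h⟩, rfl⟩)

/-- On the cube `x_S · x_T = x_{S ∪ T}` (`xᵢ² = xᵢ`). [folklore] -/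
theorem chlt_mono_mul (S T : Finset α) : χ[S] * χ[T] = χ[S ∪ T] := by
  funext X
  simp only [Pi.mul_apply, Finset.union_subset_iff]
  by_cases h1 : S ⊆ X <;> by_cases h2 : T ⊆ X <;> simp [h1, h2]

/-- `V a · x_T ⊆ V (a + b)` for `#T ≤ b`. [folklore] -/
theorem chlt_mul_mono_mem {a b : ℕ} {f : Finset α → ZMod 2} (hf : f ∈ V[a]) {T : Finset α}
    (hT : T.card ≤ b) : f * χ[T] ∈ V[a + b] := by
  induction hf using Submodule.span_induction with
  | mem x hx =>
    obtain ⟨⟨S, hS⟩, rfl⟩ := hx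
    show χ[S] * χ[T] ∈ V[a + b]
    rw [chlt_mono_mul]
    exact chlt_mono_mem ((Finset.card_union_le S T).trans (Nat.add_le_add hS hT))
  | zero => rw [zero_mul]; exact Submodule.zero_mem _
  | add x y _ _ hx hy => rw [add_mul]; exact Submodule.add_mem _ hx hy
  | smul c x _ hx => rw [smul_mul_assoc]; exact Submodule.smul_mem _ c hx

/-- The grading `V a · V b ⊆ V (a + b)` (degrees of Boolean functions add under products; this is
the step "`g₁(x) p(x)` is of degree `≤ n/2 - t + d`" of the paper). [cite: ChattopadhyayHatamiLovettTal2019, §3, proof of Thm. 13 (pp. 22:8–9)] -/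
theorem chlt_mul_mem {a b : ℕ} {f g : Finset α → ZMod 2} (hf : f ∈ V[a]) (hg : g ∈ V[b]) :
    f * g ∈ V[a + b] := by
  induction hg using Submodule.span_induction with
  | mem x hx =>
    obtain ⟨⟨T, hT⟩, rfl⟩ := hx
    exact chlt_mul_mono_mem hf hT
  | zero => rw [mul_zero]; exact Submodule.zero_mem _
  | add x y _ _ hx hy => rw [mul_add]; exact Submodule.add_mem _ hx hy
  | smul c x _ hx => rw [mul_smul_comm]; exact Submodule.smul_mem _ c hx

/-- Translating a monomial by `D` (i.e. flipping the variables in `D`) gives a combination of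
monomials of no larger degree: `x_S(X ∆ D) = ∑_{T ⊆ S} [S \ T ⊆ D] · x_T(X)`. [folklore] -/
theorem chlt_mono_symmDiff (S D : Finset α) :
    (fun X : Finset α => χ[S] (X ∆ D))
      = ∑ T ∈ S.powerset, (if S \ T ⊆ D then (1 : ZMod 2) else 0) • χ[T] := by
  funext X
  simp only [Finset.sum_apply, Pi.smul_apply, smul_eq_mul]
  rw [chlt_ite_subset]
  have hfac : ∀ i ∈ S, (if i ∈ X ∆ D then (1 : ZMod 2) else 0)
      = (if i ∈ X then (1 : ZMod 2) else 0) + (if i ∈ D then (1 : ZMod 2) else 0) := by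
    intro i _
    by_cases h1 : i ∈ X <;> by_cases h2 : i ∈ D <;> simp [Finset.mem_symmDiff, h1, h2]
    decide
  rw [Finset.prod_congr rfl hfac, Finset.prod_add]
  refine Finset.sum_congr rfl fun T _ => ?_
  rw [← chlt_ite_subset, ← chlt_ite_subset, mul_comm]

/-- `V r` is stable under the flips `X ↦ X ∆ D` (the paper's "replacing `xᵢ` with `1 - xᵢ`"
does not change the degree). [cite: ChattopadhyayHatamiLovettTal2019, §3, proof of Thm. 13 (pp. 22:8–9)] -/
theorem chlt_comp_symmDiff_mem {r : ℕ} (D : Finset α) {f : Finset α → ZMod 2} (hf : f ∈ V[r]) :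
    (fun X : Finset α => f (X ∆ D)) ∈ V[r] := by
  induction hf using Submodule.span_induction with
  | mem x hx =>
    obtain ⟨⟨S, hS⟩, rfl⟩ := hx
    show (fun X : Finset α => χ[S] (X ∆ D)) ∈ V[r]
    rw [chlt_mono_symmDiff]
    refine Submodule.sum_mem _ fun T hT => Submodule.smul_mem _ _ (chlt_mono_mem ?_)
    exact (Finset.card_le_card (Finset.mem_powerset.1 hT)).trans hS
  | zero => exact Submodule.zero_mem _
  | add x y _ _ hx hy => exact Submodule.add_mem _ hx hy
  | smul c x _ hx => exact Submodule.smul_mem _ c hx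

/-- The Boolean function of an `𝔽₂`-polynomial of total degree `≤ d` lies in `V d` (on Boolean
points `xᵢ^e = xᵢ` for `e ≥ 1`, so each monomial is `x_{supp}` with `#supp ≤` its degree). [folklore] -/
theorem chlt_eval_mem {d : ℕ} (p : MvPolynomial α (ZMod 2)) (hp : p.totalDegree ≤ d) :
    (fun X : Finset α => MvPolynomial.eval (fun i => if i ∈ X then (1 : ZMod 2) else 0) p)
      ∈ V[d] := by
  have h : (fun X : Finset α => MvPolynomial.eval (fun i => if i ∈ X then (1 : ZMod 2) else 0) p)
      = ∑ m ∈ p.support, p.coeff m • χ[m.support] := by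
    funext X
    rw [Finset.sum_apply, MvPolynomial.eval_eq]
    refine Finset.sum_congr rfl fun m _ => ?_
    simp only [Pi.smul_apply, smul_eq_mul]
    congr 1
    rw [chlt_ite_subset]
    refine Finset.prod_congr rfl fun i hi => ?_
    have hmi : m i ≠ 0 := Finsupp.mem_support_iff.1 hi
    by_cases hiX : i ∈ X
    · rw [if_pos hiX, one_pow]
    · rw [if_neg hiX, zero_pow hmi]
  rw [h]
  refine Submodule.sum_mem _ fun m hm => Submodule.smul_mem _ _ (chlt_mono_mem ?_)
  calc m.support.card = ∑ i ∈ m.support, 1 := by simp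
    _ ≤ ∑ i ∈ m.support, m i :=
        Finset.sum_le_sum fun i hi => Nat.one_le_iff_ne_zero.2 (Finsupp.mem_support_iff.1 hi)
    _ = m.sum (fun _ e => e) := rfl
    _ ≤ p.totalDegree := MvPolynomial.le_totalDegree hm
    _ ≤ d := hp

variable [Fintype α]

/-- **Ball interpolation** (the Razborov–Smolensky–Kopparty dimension argument, lower ball):
every function agrees on the Hamming ball `{#X ≤ k}` with an element of `V k` ("any function
`g : Uₜ → 𝔽₂` can be decomposed as `g₁ Mₜ + g₂` with `deg gᵢ ≤ n/2 - t`", lower half), via the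
Möbius count `#[Y, X] = 2^{#X-#Y} ≡ [Y = X] (mod 2)`. [cite: ChattopadhyayHatamiLovettTal2019, §3, proof of Thm. 13 (pp. 22:8–9)] -/
theorem chlt_interp_low (k : ℕ) (G : Finset α → ZMod 2) :
    ∃ g ∈ V[k], ∀ X : Finset α, X.card ≤ k → g X = G X := by
  have key : ∀ X Y : Finset α, X.card ≤ k →
      (∑ S ∈ univ.filter (fun S : Finset α => Y ⊆ S ∧ S.card ≤ k), χ[S]) X
        = if Y = X then 1 else 0 := by
    intro X Y hX
    simp only [Finset.sum_apply, Finset.sum_boole]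
    by_cases hYX : Y ⊆ X
    · -- `{S : Y ⊆ S ⊆ X}` is the image of the powerset of `X \ Y` under `Y ∪ ·`
      have hset : (univ.filter (fun S : Finset α => Y ⊆ S ∧ S.card ≤ k)).filter (fun S => S ⊆ X)
          = ((X \ Y).powerset).image (fun T => Y ∪ T) := by
        ext S
        simp only [Finset.mem_filter, Finset.mem_univ, true_and, Finset.mem_image,
          Finset.mem_powerset]
        constructor
        · rintro ⟨⟨hYS, -⟩, hSX⟩
          exact ⟨S \ Y, Finset.sdiff_subset_sdiff hSX (Finset.Subset.refl _),
            Finset.union_sdiff_of_subset hYS⟩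
        · rintro ⟨T, hT, rfl⟩
          have hTX : T ⊆ X := hT.trans Finset.sdiff_subset
          exact ⟨⟨Finset.subset_union_left,
            (Finset.card_le_card (Finset.union_subset hYX hTX)).trans hX⟩,
            Finset.union_subset hYX hTX⟩
      have hinj : Set.InjOn (fun T : Finset α => Y ∪ T) ((X \ Y).powerset : Set (Finset α)) := by
        intro T hT T' hT' h
        have hd : Disjoint Y T :=
          (Finset.subset_sdiff.1 (Finset.mem_powerset.1 (Finset.mem_coe.1 hT))).2.symm
        have hd' : Disjoint Y T' :=
          (Finset.subset_sdiff.1 (Finset.mem_powerset.1 (Finset.mem_coe.1 hT'))).2.symm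
        have h' := congrArg (fun S : Finset α => S \ Y) h
        simpa only [Finset.union_sdiff_cancel_left hd, Finset.union_sdiff_cancel_left hd'] using h'
      rw [hset, Finset.card_image_of_injOn hinj, Finset.card_powerset, Nat.cast_pow]
      have h2 : ((2 : ℕ) : ZMod 2) = 0 := by decide
      rw [h2]
      by_cases hE : Y = X
      · subst hE
        simp
      · have hlt : Y.card < X.card :=
          Finset.card_lt_card (Finset.ssubset_iff_subset_ne.2 ⟨hYX, hE⟩)
        rw [if_neg hE, Finset.card_sdiff_of_subset hYX, zero_pow (Nat.sub_ne_zero_of_lt hlt)]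
    · have hne : Y ≠ X := fun h => hYX (h ▸ Finset.Subset.refl _)
      rw [if_neg hne, Finset.filter_eq_empty_iff.2 (fun S hS hSX =>
        hYX ((Finset.mem_filter.1 hS).2.1.trans hSX)), Finset.card_empty, Nat.cast_zero]
  refine ⟨∑ Y ∈ univ.filter (fun Y : Finset α => Y.card ≤ k),
      G Y • ∑ S ∈ univ.filter (fun S : Finset α => Y ⊆ S ∧ S.card ≤ k), χ[S], ?_, ?_⟩
  · refine Submodule.sum_mem _ fun Y _ => Submodule.smul_mem _ _ (Submodule.sum_mem _ fun S hS => ?_)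
    exact chlt_mono_mem (Finset.mem_filter.1 hS).2.2
  · intro X hX
    rw [Finset.sum_apply]
    simp only [Pi.smul_apply, smul_eq_mul]
    rw [Finset.sum_congr rfl fun Y _ => by rw [key X Y hX]]
    simp only [mul_ite, mul_one, mul_zero]
    rw [Finset.sum_ite_eq', if_pos (show X ∈ univ.filter (fun Y : Finset α => Y.card ≤ k) from
      Finset.mem_filter.2 ⟨Finset.mem_univ _, hX⟩)]

/-- Ball interpolation on the upper ball `{#X ≥ N - k}`, by complementation. [cite: ChattopadhyayHatamiLovettTal2019, §3, proof of Thm. 13 (pp. 22:8–9)] -/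
theorem chlt_interp_high (k : ℕ) (G : Finset α → ZMod 2) :
    ∃ g ∈ V[k], ∀ X : Finset α, Fintype.card α - k ≤ X.card → g X = G X := by
  obtain ⟨g, hg, hgG⟩ := chlt_interp_low k (fun Y => G (Y ∆ univ))
  refine ⟨fun X => g (X ∆ univ), chlt_comp_symmDiff_mem univ hg, fun X hX => ?_⟩
  have hc : ∀ Z : Finset α, Z ∆ univ = Zᶜ := fun Z => by
    ext i
    simp [Finset.mem_symmDiff]
  simp only []
  rw [hgG (X ∆ univ), symmDiff_symmDiff_cancel_right]
  rw [hc, Finset.card_compl]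
  omega

/-- **The dimension bound**: a set `A` of points of the lower ball of radius `k` where `P = 0` and
points of the upper ball where `P = 1`, for `P ∈ V d`, has at most `Ball (k + d)` elements
(every function on `A` is the restriction of an element `g₂ + g₁ P` of `V (k + d)`, so
`2^{#A} ≤ |V (k+d)| ≤ 2^{Ball (k+d)}`; the paper's `|Aₜ| ≤ ∑_{i ≤ n/2-t+d} C(n,i)`, "a dimension
argument similar to that used by Razborov and Smolensky", Kopparty's Lemma 6). [cite: ChattopadhyayHatamiLovettTal2019, §3, proof of Thm. 13 (pp. 22:8–9)] -/
theorem chlt_card_agree_le (k d : ℕ) (P : Finset α → ZMod 2) (hP : P ∈ V[d])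
    (A : Finset (Finset α))
    (hA : ∀ X ∈ A, (X.card ≤ k ∧ P X = 0) ∨ (Fintype.card α - k ≤ X.card ∧ P X = 1)) :
    A.card ≤ (univ.filter (fun S : Finset α => S.card ≤ k + d)).card := by
  have hsurj : Function.Surjective
      (fun q : V[k + d] => fun a : A => (q : Finset α → ZMod 2) a) := by
    intro g
    set G : Finset α → ZMod 2 := fun X => if h : X ∈ A then g ⟨X, h⟩ else 0 with hG
    obtain ⟨g₂, hg₂, h₂⟩ := chlt_interp_low k G
    obtain ⟨g₁, hg₁, h₁⟩ := chlt_interp_high k (G - g₂)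
    refine ⟨⟨g₂ + g₁ * P, Submodule.add_mem _ (chlt_V_mono (Nat.le_add_right k d) hg₂)
      (chlt_mul_mem hg₁ hP)⟩, ?_⟩
    funext ⟨X, hX⟩
    simp only [Pi.add_apply, Pi.mul_apply]
    rcases hA X hX with ⟨hXk, hP0⟩ | ⟨hXk, hP1⟩
    · rw [hP0, mul_zero, add_zero, h₂ X hXk]
      simp only [hG, dif_pos hX]
    · rw [hP1, mul_one, h₁ X hXk, Pi.sub_apply, add_sub_cancel]
      simp only [hG, dif_pos hX]
  have h1 : Nat.card (A → ZMod 2) ≤ Nat.card V[k + d] := Nat.card_le_card_of_surjective _ hsurj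
  have h2 : Nat.card V[k + d] ≤ Nat.card ({S : Finset α // S.card ≤ k + d} → ZMod 2) := by
    refine Nat.card_le_card_of_surjective
      (fun c : {S : Finset α // S.card ≤ k + d} → ZMod 2 =>
        (⟨∑ i, c i • χ[i.1], Submodule.sum_mem _ fun i _ =>
          Submodule.smul_mem _ _ (chlt_mono_mem i.2)⟩ : V[k + d])) ?_
    rintro ⟨q, hq⟩
    obtain ⟨c, hc⟩ := (Submodule.mem_span_range_iff_exists_fun (ZMod 2)).1 hq
    exact ⟨c, Subtype.ext hc⟩
  have h := h1.trans h2
  rw [Nat.card_fun, Nat.card_fun, Nat.card_zmod, Nat.card_eq_finsetCard, Nat.card_eq_fintype_card,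
    Fintype.card_subtype] at h
  exact (Nat.pow_le_pow_iff_right (by norm_num)).1 h


/-- In `𝔽₂`, not being `1` means being `0`. [folklore] -/
theorem chlt_zmod2_eq_zero_of_ne_one {v : ZMod 2} (h : ¬v = 1) : v = 0 := by
  revert v h; decide

/-- **The level bound** (`e_t ≤ 2 ∑_{i=1}^{d} C(n, n/2-t+i) / 2ⁿ` in CHLT): for `2k < N` and
`P ∈ V d`, `∑_X (-1)^{P X} T_k(#X) ≤ 2 (Ball (k+d) - Ball k)`, where
`T_k(w) = [w ≤ k] - [N - k ≤ w]` (`2|Aₜ| - |Uₜ|`, with `|Uₜ| = 2 Ball k` by complementation).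
[cite: ChattopadhyayHatamiLovettTal2019, §3, proof of Thm. 13 (pp. 22:8–9)] -/
theorem chlt_level_bound (k d : ℕ) (hk : 2 * k < Fintype.card α) (P : Finset α → ZMod 2)
    (hP : P ∈ V[d]) :
    ∑ X : Finset α, (if P X = 1 then (-1 : ℝ) else 1) *
        ((if X.card ≤ k then (1 : ℝ) else 0) - (if Fintype.card α - k ≤ X.card then (1 : ℝ) else 0))
      ≤ 2 * ((univ.filter (fun S : Finset α => S.card ≤ k + d)).card : ℝ)
        - 2 * ((univ.filter (fun S : Finset α => S.card ≤ k)).card : ℝ) := by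
  set L := univ.filter (fun X : Finset α => X.card ≤ k) with hL
  set H := univ.filter (fun X : Finset α => Fintype.card α - k ≤ X.card) with hH
  have hdisj : Disjoint L H := by
    rw [hL, hH, Finset.disjoint_filter]
    intro X _ h1 h2
    omega
  set A := L.filter (fun X => ¬P X = 1) ∪ H.filter (fun X => P X = 1) with hAdef
  have hAcard : A.card = (L.filter (fun X => ¬P X = 1)).card + (H.filter (fun X => P X = 1)).card :=
    Finset.card_union_of_disjoint (Finset.disjoint_filter_filter hdisj)
  have hA : ∀ X ∈ A, (X.card ≤ k ∧ P X = 0) ∨ (Fintype.card α - k ≤ X.card ∧ P X = 1) := by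
    intro X hX
    rcases Finset.mem_union.1 hX with h | h
    · rw [Finset.mem_filter] at h
      exact Or.inl ⟨(Finset.mem_filter.1 h.1).2, chlt_zmod2_eq_zero_of_ne_one h.2⟩
    · rw [Finset.mem_filter] at h
      exact Or.inr ⟨(Finset.mem_filter.1 h.1).2, h.2⟩
  have hAle : A.card ≤ (univ.filter (fun S : Finset α => S.card ≤ k + d)).card :=
    chlt_card_agree_le k d P hP A hA
  have hHL : H.card = L.card := by
    have hmap : H = L.map ⟨compl, compl_injective⟩ := by
      ext X
      simp only [hH, hL, Finset.mem_filter, Finset.mem_univ, true_and, Finset.mem_map,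
        Function.Embedding.coeFn_mk]
      constructor
      · intro h
        refine ⟨Xᶜ, ?_, compl_compl X⟩
        rw [Finset.card_compl]
        omega
      · rintro ⟨Y, hY, rfl⟩
        rw [Finset.card_compl]
        omega
    rw [hmap, Finset.card_map]
  -- evaluate the signed sum
  have hsum : ∑ X : Finset α, (if P X = 1 then (-1 : ℝ) else 1) *
        ((if X.card ≤ k then (1 : ℝ) else 0) - (if Fintype.card α - k ≤ X.card then (1 : ℝ) else 0))
      = ∑ X ∈ L, (if P X = 1 then (-1 : ℝ) else 1) - ∑ X ∈ H, (if P X = 1 then (-1 : ℝ) else 1) := by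
    simp only [mul_sub, mul_ite, mul_one, mul_zero, Finset.sum_sub_distrib]
    rw [hL, hH, Finset.sum_filter, Finset.sum_filter]
  have hLsum : ∑ X ∈ L, (if P X = 1 then (-1 : ℝ) else 1)
      = ((L.filter (fun X => ¬P X = 1)).card : ℝ) - ((L.filter (fun X => P X = 1)).card : ℝ) := by
    rw [Finset.sum_ite, Finset.sum_const, Finset.sum_const]
    simp only [nsmul_eq_mul, mul_neg, mul_one]
    ring
  have hHsum : ∑ X ∈ H, (if P X = 1 then (-1 : ℝ) else 1)
      = ((H.filter (fun X => ¬P X = 1)).card : ℝ) - ((H.filter (fun X => P X = 1)).card : ℝ) := by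
    rw [Finset.sum_ite, Finset.sum_const, Finset.sum_const]
    simp only [nsmul_eq_mul, mul_neg, mul_one]
    ring
  have hLc : ((L.filter (fun X => P X = 1)).card : ℝ) + ((L.filter (fun X => ¬P X = 1)).card : ℝ)
      = L.card := by
    exact_mod_cast Finset.card_filter_add_card_filter_not (s := L) (fun X => P X = 1)
  have hHc : ((H.filter (fun X => P X = 1)).card : ℝ) + ((H.filter (fun X => ¬P X = 1)).card : ℝ)
      = H.card := by
    exact_mod_cast Finset.card_filter_add_card_filter_not (s := H) (fun X => P X = 1)
  have hHL' : (H.card : ℝ) = L.card := by exact_mod_cast hHL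
  have hAcard' : (A.card : ℝ)
      = ((L.filter (fun X => ¬P X = 1)).card : ℝ) + ((H.filter (fun X => P X = 1)).card : ℝ) := by
    exact_mod_cast hAcard
  have hAle' : (A.card : ℝ) ≤ (univ.filter (fun S : Finset α => S.card ≤ k + d)).card := by
    exact_mod_cast hAle
  rw [hsum, hLsum, hHsum]
  linarith

omit [Fintype α] [DecidableEq α] in
/-- The parity-free threshold decomposition `N - 2w = ∑_{k<N} ([w ≤ k] - [N - k ≤ w])` of the
paper's `∑ᵢ (-1)^{xᵢ} = n - 2|x| = 2 ∑ₜ Tₜ(x)`. [folklore] -/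
theorem chlt_threshold_sum (N w : ℕ) (hw : w ≤ N) :
    ((N : ℝ) - 2 * (w : ℝ)) = ∑ k ∈ Finset.range N,
      ((if w ≤ k then (1 : ℝ) else 0) - (if N - k ≤ w then (1 : ℝ) else 0)) := by
  rw [Finset.sum_sub_distrib, Finset.sum_boole, Finset.sum_boole]
  have h1 : (Finset.range N).filter (fun k => w ≤ k) = Finset.Ico w N := by
    ext k
    simp only [Finset.mem_filter, Finset.mem_range, Finset.mem_Ico]
    exact ⟨fun h => ⟨h.2, h.1⟩, fun h => ⟨h.2, h.1⟩⟩
  have h2 : (Finset.range N).filter (fun k => N - k ≤ w) = Finset.Ico (N - w) N := by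
    ext k
    simp only [Finset.mem_filter, Finset.mem_range, Finset.mem_Ico]
    exact ⟨fun h => ⟨by omega, h.1⟩, fun h => ⟨h.2, by omega⟩⟩
  rw [h1, h2, Nat.card_Ico, Nat.card_Ico, Nat.cast_sub hw, Nat.cast_sub (Nat.sub_le N w),
    Nat.cast_sub hw]
  ring

omit [Fintype α] [DecidableEq α] in
/-- The symmetry `T_k = T_{N-1-k}` of the thresholds (used to fold `k ≥ N/2` onto `k < N/2`;
this replaces the paper's "assume `n` even"). [folklore] -/
theorem chlt_threshold_symm (N k w : ℕ) (hk : k < N) (hw : w ≤ N) :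
    ((if w ≤ k then (1 : ℝ) else 0) - (if N - k ≤ w then (1 : ℝ) else 0))
      = ((if w ≤ N - 1 - k then (1 : ℝ) else 0) - (if N - (N - 1 - k) ≤ w then (1 : ℝ) else 0)) := by
  by_cases h1 : w ≤ k <;> by_cases h2 : N - k ≤ w <;> by_cases h3 : w ≤ N - 1 - k <;>
    by_cases h4 : N - (N - 1 - k) ≤ w <;> simp only [h1, h2, h3, h4, if_true, if_false] <;>
    (try norm_num) <;> omega

/-- `Ball (k + d) = Ball k + ∑_{j<d} Sphere (k + 1 + j)`. [folklore] -/
theorem chlt_ball_eq_ball_add_spheres (k d : ℕ) :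
    (univ.filter (fun S : Finset α => S.card ≤ k + d)).card
      = (univ.filter (fun S : Finset α => S.card ≤ k)).card
        + ∑ j ∈ Finset.range d, (univ.filter (fun S : Finset α => S.card = k + 1 + j)).card := by
  induction d with
  | zero => simp
  | succ d ih =>
    have hsplit : univ.filter (fun S : Finset α => S.card ≤ k + (d + 1))
        = univ.filter (fun S : Finset α => S.card ≤ k + d)
          ∪ univ.filter (fun S : Finset α => S.card = k + 1 + d) := by
      ext S
      simp only [Finset.mem_filter, Finset.mem_univ, true_and, Finset.mem_union]
      omega
    rw [hsplit, Finset.card_union_of_disjoint (Finset.disjoint_filter.2 fun S _ h1 => by omega), ih,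
      Finset.sum_range_succ]
    omega

/-- Distinct spheres are disjoint: `∑_{k ∈ s} Sphere (φ k) ≤ 2^N` for `φ` injective on `s` (the
paper's `∑ₜ C(n, n/2 - t + i) / 2ⁿ ≤ 1`). [folklore] -/
theorem chlt_sum_spheres_le (s : Finset ℕ) (φ : ℕ → ℕ)
    (hφ : ∀ a ∈ s, ∀ b ∈ s, φ a = φ b → a = b) :
    ∑ k ∈ s, (univ.filter (fun S : Finset α => S.card = φ k)).card ≤ 2 ^ Fintype.card α := by
  have hd : (s : Set ℕ).PairwiseDisjoint (fun k => univ.filter (fun S : Finset α => S.card = φ k)) := by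
    intro a ha b hb hab
    exact Finset.disjoint_filter.2 fun S _ h1 h2 => hab (hφ a ha b hb (h1.symm.trans h2))
  rw [← Finset.card_biUnion hd, ← Fintype.card_finset]
  exact Finset.card_le_univ _

/-- Folding the thresholds: `∑_{k<N} Sphere (k⋆ + 1 + j) ≤ 2 · 2^N`, where `k⋆ = k` if `2k < N` and
`k⋆ = N - 1 - k` otherwise (each value is hit at most twice). [folklore] -/
theorem chlt_sum_fold_le (j : ℕ) :
    ∑ k ∈ Finset.range (Fintype.card α),
      (univ.filter (fun S : Finset α => S.card =
        (if 2 * k < Fintype.card α then k else Fintype.card α - 1 - k) + 1 + j)).card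
      ≤ 2 * 2 ^ Fintype.card α := by
  rw [← Finset.sum_filter_add_sum_filter_not (Finset.range (Fintype.card α))
    (fun k => 2 * k < Fintype.card α), two_mul]
  refine Nat.add_le_add ?_ ?_
  · calc ∑ k ∈ (Finset.range (Fintype.card α)).filter (fun k => 2 * k < Fintype.card α),
          (univ.filter (fun S : Finset α => S.card =
            (if 2 * k < Fintype.card α then k else Fintype.card α - 1 - k) + 1 + j)).card
        = ∑ k ∈ (Finset.range (Fintype.card α)).filter (fun k => 2 * k < Fintype.card α),
          (univ.filter (fun S : Finset α => S.card = k + 1 + j)).card := by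
          refine Finset.sum_congr rfl fun k hk => ?_
          rw [if_pos (Finset.mem_filter.1 hk).2]
      _ ≤ 2 ^ Fintype.card α :=
          chlt_sum_spheres_le _ (fun k => k + 1 + j) (fun a _ b _ h => by omega)
  · calc ∑ k ∈ (Finset.range (Fintype.card α)).filter (fun k => ¬2 * k < Fintype.card α),
          (univ.filter (fun S : Finset α => S.card =
            (if 2 * k < Fintype.card α then k else Fintype.card α - 1 - k) + 1 + j)).card
        = ∑ k ∈ (Finset.range (Fintype.card α)).filter (fun k => ¬2 * k < Fintype.card α),
          (univ.filter (fun S : Finset α => S.card = Fintype.card α - 1 - k + 1 + j)).card := by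
          refine Finset.sum_congr rfl fun k hk => ?_
          rw [if_neg (Finset.mem_filter.1 hk).2]
      _ ≤ 2 ^ Fintype.card α := by
          refine chlt_sum_spheres_le _ (fun k => Fintype.card α - 1 - k + 1 + j) (fun a ha b hb h => ?_)
          have ha' := Finset.mem_range.1 (Finset.mem_filter.1 ha).1
          have hb' := Finset.mem_range.1 (Finset.mem_filter.1 hb).1
          omega

/-- **CHLT Theorem 13, core form.** For `P ∈ V d` (a Boolean function of `𝔽₂`-degree `≤ d` on
the cube `Finset α`, `N = |α|`), `∑_X (-1)^{P X} (N - 2 #X) ≤ 4 d 2^N`, i.e.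
`𝔼_x [(-1)^{P(x)} ∑ᵢ (-1)^{xᵢ}] ≤ 4d` (the quantity `E` of the paper, after the sign
normalisation). [cite: ChattopadhyayHatamiLovettTal2019, §3, proof of Thm. 13 (pp. 22:8–9)] -/
theorem chlt_core (d : ℕ) (P : Finset α → ZMod 2) (hP : P ∈ V[d]) :
    ∑ X : Finset α, (if P X = 1 then (-1 : ℝ) else 1) * ((Fintype.card α : ℝ) - 2 * (X.card : ℝ))
      ≤ 4 * (d : ℝ) * 2 ^ Fintype.card α := by
  have hks : ∀ k ∈ Finset.range (Fintype.card α),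
      2 * (if 2 * k < Fintype.card α then k else Fintype.card α - 1 - k) < Fintype.card α := by
    intro k hk
    have := Finset.mem_range.1 hk
    split_ifs with h
    · exact h
    · omega
  calc ∑ X : Finset α, (if P X = 1 then (-1 : ℝ) else 1) * ((Fintype.card α : ℝ) - 2 * (X.card : ℝ))
      = ∑ X : Finset α, ∑ k ∈ Finset.range (Fintype.card α), (if P X = 1 then (-1 : ℝ) else 1) *
          ((if X.card ≤ k then (1 : ℝ) else 0)
            - (if Fintype.card α - k ≤ X.card then (1 : ℝ) else 0)) := by
        refine Finset.sum_congr rfl fun X _ => ?_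
        rw [chlt_threshold_sum _ _ (Finset.card_le_univ X), Finset.mul_sum]
    _ = ∑ k ∈ Finset.range (Fintype.card α), ∑ X : Finset α, (if P X = 1 then (-1 : ℝ) else 1) *
          ((if X.card ≤ k then (1 : ℝ) else 0)
            - (if Fintype.card α - k ≤ X.card then (1 : ℝ) else 0)) := Finset.sum_comm
    _ = ∑ k ∈ Finset.range (Fintype.card α), ∑ X : Finset α, (if P X = 1 then (-1 : ℝ) else 1) *
          ((if X.card ≤ (if 2 * k < Fintype.card α then k else Fintype.card α - 1 - k)
              then (1 : ℝ) else 0)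
            - (if Fintype.card α - (if 2 * k < Fintype.card α then k else Fintype.card α - 1 - k)
              ≤ X.card then (1 : ℝ) else 0)) := by
        refine Finset.sum_congr rfl fun k hk => Finset.sum_congr rfl fun X _ => ?_
        by_cases h2k : 2 * k < Fintype.card α
        · simp only [if_pos h2k]
        · simp only [if_neg h2k]
          rw [chlt_threshold_symm _ k _ (Finset.mem_range.1 hk) (Finset.card_le_univ X)]
    _ ≤ ∑ k ∈ Finset.range (Fintype.card α),
          (2 * ((univ.filter (fun S : Finset α => S.card ≤
              (if 2 * k < Fintype.card α then k else Fintype.card α - 1 - k) + d)).card : ℝ)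
            - 2 * ((univ.filter (fun S : Finset α => S.card ≤
              (if 2 * k < Fintype.card α then k else Fintype.card α - 1 - k))).card : ℝ)) :=
        Finset.sum_le_sum fun k hk => chlt_level_bound _ d (hks k hk) P hP
    _ = ∑ k ∈ Finset.range (Fintype.card α), 2 * ∑ j ∈ Finset.range d,
          ((univ.filter (fun S : Finset α => S.card =
            (if 2 * k < Fintype.card α then k else Fintype.card α - 1 - k) + 1 + j)).card : ℝ) := by
        refine Finset.sum_congr rfl fun k _ => ?_
        rw [chlt_ball_eq_ball_add_spheres]
        push_cast
        ring
    _ = 2 * ∑ j ∈ Finset.range d, ∑ k ∈ Finset.range (Fintype.card α),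
          ((univ.filter (fun S : Finset α => S.card =
            (if 2 * k < Fintype.card α then k else Fintype.card α - 1 - k) + 1 + j)).card : ℝ) := by
        rw [← Finset.mul_sum, Finset.sum_comm]
    _ ≤ 2 * ∑ j ∈ Finset.range d, (2 * 2 ^ Fintype.card α : ℝ) := by
        gcongr with j
        exact_mod_cast chlt_sum_fold_le j
    _ = 4 * (d : ℝ) * 2 ^ Fintype.card α := by
        rw [Finset.sum_const, Finset.card_range]
        ring

end CHLTCore

section CHLTFourier

open Literature.Computability.Complexity Literature.Probability.RandomGraphs.LowDegree

/-- `sgn` of the decided bit `[v = 1]` of `v ∈ 𝔽₂` is `(-1)^v`. [folklore] -/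
theorem chlt_sgn_decide (v : ZMod 2) :
    sgn (decide (v = 1)) = if v = 1 then (-1 : ℝ) else 1 := by
  by_cases h : v = 1 <;> simp [h, sgn]

/-- `(-1)^a (-1)^b = (-1)^{a ⊕ b}`. [folklore] -/
theorem chlt_sgn_mul_sgn (a b : Bool) : sgn a * sgn b = sgn (a ^^ b) := by
  cases a <;> cases b <;> simp [sgn]

/-- `∑ᵢ (-1)^{bᵢ} = m - 2 · #{i : bᵢ = 1}`. [folklore] -/
theorem chlt_sum_sgn (m : ℕ) (b : Fin m → Bool) :
    ∑ i, sgn (b i) = (m : ℝ) - 2 * ((univ.filter fun i => b i = true).card : ℝ) := by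
  have h : ∀ i, sgn (b i) = 1 - 2 * (if b i = true then (1 : ℝ) else 0) := by
    intro i
    cases b i <;> norm_num [sgn]
  simp_rw [h]
  rw [Finset.sum_sub_distrib, Finset.sum_const, Finset.card_univ, Fintype.card_fin, ← Finset.mul_sum,
    Finset.sum_boole]
  simp

/-- **Chattopadhyay–Hatami–Lovett–Tal, Theorem 5 / Theorem 13** (ITCS 2019, §3, pp. 22:8–22:9),
proved: the first Fourier level of `f = (-1)^p`, `deg p ≤ d` over `𝔽₂`, has `L₁`-mass `≤ 4d`.
The proof follows the paper: sign normalisation by flipping variables (`x ↦ x ⊕ σ`, which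
preserves `𝔽₂`-degree), the threshold decomposition of `∑ᵢ (-1)^{xᵢ} = n - 2|x|`, and for each
threshold the Razborov–Smolensky dimension argument in Kopparty's form (`chlt_card_agree_le`),
followed by the binomial (sphere) double count; the paper's "assume `n` even" is replaced by the
parity-free folding `T_k = T_{n-1-k}`.
[cite: ChattopadhyayHatamiLovettTal2019, Thm. 5 = Thm. 13, §3 pp. 22:8–22:9] -/
theorem CHLT2019_fourierL1LevelOne_le_holds : CHLT2019_fourierL1LevelOne_le := by
  intro m d p hp
  classical
  set f : (Fin m → Bool) → Bool :=
    fun x => decide (MvPolynomial.eval (Multilinear.boolPt x) p = 1) with hf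
  -- the level-one mass is a sum over coordinates
  have hL1 : fourierL1Level f 1 = ∑ i : Fin m, |boolFourierCoeff f {i}| := by
    unfold fourierL1Level
    rw [Finset.powersetCard_one, Finset.sum_map]
    rfl
  -- signs `σᵢ = [f̂(i) < 0]`, so that `|f̂(i)| = (-1)^{σᵢ} f̂(i)`
  set σ : Fin m → Bool := fun i => decide (boolFourierCoeff f {i} < 0) with hσ
  have habs : ∀ i, |boolFourierCoeff f {i}| = sgn (σ i) * boolFourierCoeff f {i} := by
    intro i
    by_cases h : boolFourierCoeff f {i} < 0
    · have hi : σ i = true := by simp [hσ, h]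
      rw [hi, sgn_true, abs_of_neg h]
      ring
    · have hi : σ i = false := by simp [hσ, h]
      rw [hi, sgn_false, abs_of_nonneg (le_of_not_gt h), one_mul]
  have hcoef : ∀ i, boolFourierCoeff f {i} = (∑ x, sgn (f x) * sgn (x i)) / 2 ^ m := by
    intro i
    simp only [boolFourierCoeff, walsh, Finset.prod_singleton]
  -- `∑ᵢ |f̂(i)| = 2⁻ᵐ ∑ₓ (-1)^{f x} ∑ᵢ (-1)^{xᵢ ⊕ σᵢ}`
  have step2 : ∑ i : Fin m, |boolFourierCoeff f {i}|
      = (∑ x : Fin m → Bool, sgn (f x) * ∑ i, sgn (x i ^^ σ i)) / 2 ^ m := by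
    calc ∑ i : Fin m, |boolFourierCoeff f {i}|
        = ∑ i, sgn (σ i) * ((∑ x, sgn (f x) * sgn (x i)) / 2 ^ m) := by
          refine Finset.sum_congr rfl fun i _ => ?_
          rw [habs, hcoef]
      _ = (∑ i : Fin m, ∑ x : Fin m → Bool, sgn (σ i) * (sgn (f x) * sgn (x i))) / 2 ^ m := by
          rw [Finset.sum_div]
          refine Finset.sum_congr rfl fun i _ => ?_
          rw [mul_div_assoc', Finset.mul_sum]
      _ = (∑ x : Fin m → Bool, ∑ i : Fin m, sgn (σ i) * (sgn (f x) * sgn (x i))) / 2 ^ m := by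
          rw [Finset.sum_comm]
      _ = (∑ x : Fin m → Bool, sgn (f x) * ∑ i, sgn (x i ^^ σ i)) / 2 ^ m := by
          congr 1
          refine Finset.sum_congr rfl fun x _ => ?_
          rw [Finset.mul_sum]
          refine Finset.sum_congr rfl fun i _ => ?_
          rw [← chlt_sgn_mul_sgn]
          ring
  -- transport to the cube `Finset (Fin m)`: `x ↦ X = {i : xᵢ = 1}`
  set Sg : Finset (Fin m) := univ.filter (fun i => σ i = true) with hSg
  set Pf : Finset (Fin m) → ZMod 2 :=
    fun X => MvPolynomial.eval (fun i => if i ∈ X then (1 : ZMod 2) else 0) p with hPf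
  have hE : Function.Bijective (fun (X : Finset (Fin m)) (i : Fin m) => decide (i ∈ X)) := by
    refine ⟨fun X Y h => ?_, fun x => ⟨univ.filter (fun i => x i = true), ?_⟩⟩
    · ext i
      have := congr_fun h i
      simpa using this
    · funext i
      simp
  have step3 : ∑ x : Fin m → Bool, sgn (f x) * ∑ i, sgn (x i ^^ σ i)
      = ∑ X : Finset (Fin m), (if Pf X = 1 then (-1 : ℝ) else 1)
          * ((m : ℝ) - 2 * ((X ∆ Sg).card : ℝ)) := by
    refine (Fintype.sum_bijective _ hE _ _ fun X => ?_).symm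
    have hpt : (Multilinear.boolPt (R := ZMod 2) fun i : Fin m => decide (i ∈ X))
        = fun i => if i ∈ X then (1 : ZMod 2) else 0 := by
      funext i
      simp [Multilinear.boolPt]
    have hfX : sgn (f fun i => decide (i ∈ X)) = if Pf X = 1 then (-1 : ℝ) else 1 := by
      rw [hf, hPf]
      simp only [hpt]
      exact chlt_sgn_decide _
    have hset : univ.filter (fun i : Fin m => (decide (i ∈ X) ^^ σ i) = true) = X ∆ Sg := by
      ext i
      simp only [Finset.mem_filter, Finset.mem_univ, true_and, Finset.mem_symmDiff, hSg]
      cases σ i <;> by_cases hi : i ∈ X <;> simp [hi]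
    rw [hfX, chlt_sum_sgn, hset]
  -- re-centre at `Sg` (the flip `x ↦ x ⊕ σ` of the paper's "replace xᵢ by 1 - xᵢ")
  have step4 : ∑ X : Finset (Fin m), (if Pf X = 1 then (-1 : ℝ) else 1)
          * ((m : ℝ) - 2 * ((X ∆ Sg).card : ℝ))
      = ∑ Y : Finset (Fin m), (if Pf (Y ∆ Sg) = 1 then (-1 : ℝ) else 1)
          * ((m : ℝ) - 2 * (Y.card : ℝ)) := by
    refine (Fintype.sum_bijective (fun Y => Y ∆ Sg) (symmDiff_left_involutive Sg).bijective _ _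
      fun Y => ?_).symm
    simp only [symmDiff_symmDiff_cancel_right]
  -- the flipped polynomial function has `𝔽₂`-degree `≤ d`, so the core bound applies
  have hP : (fun Y : Finset (Fin m) => Pf (Y ∆ Sg))
      ∈ Submodule.span (ZMod 2)
          (Set.range fun S : {S : Finset (Fin m) // S.card ≤ d} =>
            fun X : Finset (Fin m) => if S.1 ⊆ X then (1 : ZMod 2) else 0) :=
    chlt_comp_symmDiff_mem Sg (chlt_eval_mem p hp)
  have hcore := chlt_core d (fun Y : Finset (Fin m) => Pf (Y ∆ Sg)) hP
  simp only [Fintype.card_fin] at hcore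
  -- assemble
  rw [hL1, step2, step3, step4, div_le_iff₀ (by positivity)]
  exact hcore

end CHLTFourier

end Literature.Computability.QuantumComplexity

end CHLTProof
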